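import Summits.Ventures.GridStability.Models.InverterBridges
import Literature.MathematicalPhysics.PowerSystems.SMIBEnergyRegionOfAttraction

/-!
# GridStability/Models/InverterDroopEnergyRoa — the energy well of the reduced droop grid-forming
# inverter (vs. an infinite bus) lies in the region of attraction of its synchronous equilibrium

Cell `gridfusion` (LADDER-GRIDFUSION; APEX LINE = inverter-dominated networks, director RULINGS 3 (1);
rung G3 inverter models / energy-function route R-EN of lit/6-REGISTER §9.4). Written by seat
gridfusion-lit-6 as the first CONSUMER of the two kernel objects it composes, both imported UNCHANGED:

* model-3's bridge `InverterDroop.ReducedParams.toSMIB` (`Models/InverterBridges.lean`): the reduced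
  droop-controlled converter-vs-infinite-bus model `δ̇ = ω_b(ω − ω_e)`,
  `(ω_b/(k_i ω_c)) ω̇ = p* − P_max sin δ − (ω_b/k_i)(ω − ω_set)` [cite: Qoria2020, eqs. (III-46),
  (V-13)], [cite: SchifferEtAl2014, Remark 3.3] IS, in the speed deviation `Ω = ω_b(ω − ω_e)` and for
  `ω_set = ω_e`, the classical SMIB swing equation of `Literature.MathematicalPhysics.PowerSystems.SMIB`
  with `M = 1/(k_i ω_c)`, `D = 1/k_i`, `P_m = p*`, `P_e^max = P_max` (`isSolution_toSMIB`);
* lit-6's textbook theorem `SMIB.energyWell_subset_regionOfAttraction`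
  (`Literature/MathematicalPhysics/PowerSystems/SMIBEnergyRegionOfAttraction.lean`, Sauer–Pai §9.2 /
  §9.6.2 via Barbashin–Krasovskii): for the damped classical SMIB the energy well below `V_cr` is
  positively invariant and inside the region of attraction of the s.e.p.

RESULT (`InverterDroop.ReducedParams.energyWell_roa`). Let `P` have `ω_b ≠ 0`, `k_i > 0`, `ω_c > 0`,
`P_max > 0`, `ω_set = ω_e`, and let `δs ∈ [0, π/2)` satisfy `p* = P_max sin δs`. For ANY
`c < V_cr(δs) = −p*(π − 2δs) + 2P_max cos δs` and every solution `(δ, ω)` of the reduced droop model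
(on the whole time axis, `IsSolution`) whose initial state has `−π − δs < δ(0) < π − δs` and transient
energy `V(δ(0), ω_b(ω(0) − ω_e)) ≤ c` (`V` = Sauer–Pai (9.35) of `P.toSMIB`, i.e.
`½ (1/(k_i ω_c)) Ω² − p*(δ − δs) − P_max(cos δ − cos δs)`): the state stays in that energy well for
all `t ≥ 0`, `δ(t) → δs` and `ω(t) → ω_e`.

THREE COLUMNS. CERTIFIED: the statement above, a priori over all solutions, for MODEL
`M` = the reduced droop GFM model `InverterDroop.ReducedParams` with `ω_set = ω_e` (MODEL-VALIDITY
MV-6D: absent effects = inner voltage/current loops, LC(L) filter and line dynamics, dc side, current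
limitation (the `dωSat` branch is NOT covered), voltage-magnitude dynamics; infinite bus) and CLASS
`C` = initial states in the energy well below `V_cr`. «Inertia» `1/(k_i ω_c)` and «damping» `1/k_i` are
control gains. VALIDATED / numerical comparison: none claimed here. Nothing in this file says a
converter or a grid is stable.
-/

noncomputable section

open Real Set Filter Topology

namespace Summit.Ventures.GridStability.Models

open Literature.MathematicalPhysics.PowerSystems

namespace InverterDroop.ReducedParams

variable (P : InverterDroop.ReducedParams)

/-- **Energy well ⊆ region of attraction for the reduced droop grid-forming inverter against an
infinite bus** (R-EN route: model-3's swing-equation identification `toSMIB`/`isSolution_toSMIB` +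
the textbook energy-well theorem `SMIB.energyWell_subset_regionOfAttraction`). Hypotheses: `ω_b ≠ 0`,
`k_i > 0`, `ω_c > 0`, `P_max > 0`, `ω_set = ω_e`, `p* = P_max sin δs` with `0 ≤ δs < π/2`,
`c < V_cr(δs)`; `(δ, ω)` a solution of the reduced model with `δ 0` in the angle window
`(−π − δs, π − δs)` and `V(δ 0, ω_b(ω 0 − ω_e)) ≤ c`. Conclusions: the window-and-energy condition
holds for all `t ≥ 0`, `δ t → δs`, `ω t → ω_e`. MODELLED: MV-6D; no current saturation.
[cite: Qoria2020, eqs. (III-21)–(III-22), (III-46), (V-13)] -/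
theorem energyWell_roa (hb : P.ωb ≠ 0) (hi : 0 < P.ki) (hc : 0 < P.ωc) (hPmax : 0 < P.Pmax)
    (hω : P.ωset = P.ωe) {δs : ℝ} (heq : P.pref = P.Pmax * Real.sin δs) (h0 : 0 ≤ δs)
    (h1 : δs < π / 2) {c : ℝ} (hcr : c < P.toSMIB.criticalEnergy δs) {δ ω : ℝ → ℝ}
    (hsol : P.IsSolution δ ω) (hδ0 : δ 0 ∈ Ioo (-π - δs) (π - δs))
    (hV0 : P.toSMIB.energy δs (δ 0, P.ωb * (ω 0 - P.ωe)) ≤ c) :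
    (∀ t, 0 ≤ t → δ t ∈ Ioo (-π - δs) (π - δs) ∧
      P.toSMIB.energy δs (δ t, P.ωb * (ω t - P.ωe)) ≤ c) ∧
    Tendsto δ atTop (𝓝 δs) ∧ Tendsto ω atTop (𝓝 P.ωe) := by
  -- the swing-equation state `X = (δ, Ω)`, `Ω = ω_b (ω − ω_e)`, solves `X' = vectorField X`
  set X : ℝ → ℝ × ℝ := fun t => (δ t, P.ωb * (ω t - P.ωe)) with hXdef
  have hX : ∀ T : ℝ, ∀ t ∈ Icc 0 T,
      HasDerivWithinAt X (P.toSMIB.vectorField (X t)) (Icc 0 T) t := by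
    intro T t _
    obtain ⟨hδ', hΩ'⟩ := P.isSolution_toSMIB hb hi.ne' hc.ne' hω hsol t
    exact (hδ'.prodMk hΩ').hasDerivWithinAt
  -- the SMIB record of the droop model has positive inertia, damping and `P_e^max`
  have hM : 0 < P.toSMIB.M := by
    show 0 < 1 / (P.ki * P.ωc)
    positivity
  have hD : 0 < P.toSMIB.D := by
    show 0 < 1 / P.ki
    positivity
  have hPmax' : 0 < P.toSMIB.Pmax := hPmax
  have heq' : P.toSMIB.IsEquilibriumAngle δs := heq
  have key := (P.toSMIB.energyWell_subset_regionOfAttraction hM hD hPmax' heq' h0 h1 hcr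
    (y := X 0) hδ0 hV0).2 X rfl hX
  obtain ⟨hstay, htend⟩ := key
  refine ⟨fun t ht => hstay t ht, ?_, ?_⟩
  · -- `δ t = (X t).1 → δs`
    have h := (continuous_fst.tendsto (δs, (0 : ℝ))).comp htend
    simpa [hXdef, Function.comp_def] using h
  · -- `ω t = (X t).2 / ω_b + ω_e → 0 / ω_b + ω_e = ω_e`
    have h := (continuous_snd.tendsto (δs, (0 : ℝ))).comp htend
    have h2 : Tendsto (fun t => P.ωb * (ω t - P.ωe)) atTop (𝓝 0) := by
      simpa [hXdef, Function.comp_def] using h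
    have h3 : Tendsto (fun t => P.ωb * (ω t - P.ωe) / P.ωb + P.ωe) atTop (𝓝 (0 / P.ωb + P.ωe)) :=
      (h2.div_const P.ωb).add_const P.ωe
    rw [zero_div, zero_add] at h3
    refine h3.congr fun t => ?_
    rw [mul_div_cancel_left₀ _ hb]
    ring

end InverterDroop.ReducedParams

end Summit.Ventures.GridStability.Models

end
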